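import Summits.HodgeConjecture.HodgeConjecture.Theorems.Ring2HypothesesDescentMotivatedBoxBlocks
import Summits.HodgeConjecture.HodgeConjecture.Theorems.HeckePrymWeilSummitOffWeilSectorMotivatedPullbackFstBelowMiddle
import Literature.AlgebraicGeometry.Motives.LefschetzStarExternalProduct
import HarnessLib

/-!
# Ring 2 hypotheses, descent face — André's Lemme 1.3.2 on the real carriers, II: blocks of a
# bi-primitive pair are sub-Lefschetz modules; `*_θ` of the top monomial

research route conditional on HC_CM; not a corollary; Q11.4-sentence-2 already refuted in dim ≥ 3.
Cell `pub-hodge-ring2` (Hodge ladder STAGE 3), seat `ring2-b05` (binder row b05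
`Ring2.Hypotheses.MotivatedImpliesAlgebraicAV`), gen 35. `HC_CM` (`Theses.RankFourFaces.CMAbelianHodge`) does
not occur in this file; nothing here proves a case of the Hodge conjecture.

Second file of the port of the tree's abstract `Motives/LefschetzStarExternalProduct` (André 1996 §1.3,
Lemme 1.3.1–1.3.2) to `H•((V ⊗ W)(ℂ); ℂ)`. For `V`, `W` smooth projective of dimensions `d₁`, `d₂`, classes
`η₁`, `η₂` with the hard Lefschetz property, PRIMITIVE `p ∈ P^{i₁}(V)`, `q ∈ P^{i₂}(W)` and the exterior sum
`θ = fst^* η₁ + snd^* η₂` (hard Lefschetz on the `(d₁ + d₂)`-fold `V ⊗ W`, `hasHardLefschetzProperty_boxSum`):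

* §1 `linearIndependent_mono` — the nonzero monomials `L₁ˢ p ⊠ L₂ᵗ q` (`s ≤ m₁`, `t ≤ m₂`) of one degree are
  linearly independent: they have distinct bidegrees, and the Künneth map
  `⨁_{i+j=N} Hⁱ(V) ⊗ Hʲ(W) ≃ Hᴺ(V ⊗ W)` (`exists_kunnethEquiv`) is injective;
* §2 `block_hardLefschetz` — **blocks are sub-Lefschetz modules**: `L_θʳ : B(p,q)ⁱ → B(p,q)^{i+2r}`, `i + r = d₁ + d₂`,
  is ONTO (injective by hard Lefschetz for `θ`, and the two pieces have the same finite dimension);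
* §3 `lefschetzInvolution_boxSum_mem_block` — **blocks are stable under André's involution `*_θ`**
  (`HodgeTheory.lefschetzInvolution`: `L_θ^{D-a}` below the middle degree, the inverse Lefschetz isomorphism
  above it — there §2 applies);
* §4 `lefschetzInvolution_boxSum_topMono` — **Lemme 1.3.1**: `*_θ (L₁^{m₁} p ⊠ L₂^{m₂} q) = c • (p ⊠ q)` with `c ≠ 0`
  (`L_θ^{m₁+m₂} (p ⊠ q)` is a nonzero multiple of the top monomial, the only monomial with `s + t = m₁ + m₂`
  that survives).

No definition, no named fact, no sorry. References: Andre1996Motifs (§1.1 p. 10, §1.3 pp. 12–13),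
Kleiman1968AlgebraicCycles (§1.2 (B), §1.4, Thm. 2.9), VoisinHodgeI2002 (§6.2.3), HatcherAT2002 (§3.2 Thm. 3.16).
-/

noncomputable section

-- every declaration of this problem lives in `Summit.HodgeConjecture.HodgeConjecture.…` (summit = sub-problem)
set_option linter.dupNamespace false

open CategoryTheory AlgebraicGeometry MonoidalCategory CartesianMonoidalCategory
open Literature.AlgebraicTopology.SingularHomology Literature.Geometry.Kaehler
open Literature.AlgebraicGeometry Literature.AlgebraicGeometry.Motives
  Literature.AlgebraicGeometry.HodgeTheory
open scoped TensorProduct DirectSum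

namespace Summit.HodgeConjecture.HodgeConjecture.Theorems

variable {d₁ d₂ : ℕ} {V W : SchemeOver ℂ} {η₁ : complexBetti V 2} {η₂ : complexBetti W 2}
variable {i₁ i₂ : ℕ} {p : complexBetti V i₁} {q : complexBetti W i₂}

/-! ## §1 Linear independence of the monomials of a block -/

/-- Over a field, the elementary tensor of two nonzero vectors is nonzero (test against a pair of linear forms
not vanishing on them). [folklore] -/
private theorem tmul_ne_zero' {U₁ U₂ : Type*} [AddCommGroup U₁] [Module ℂ U₁] [AddCommGroup U₂]
    [Module ℂ U₂] {v : U₁} {w : U₂} (hv : v ≠ 0) (hw : w ≠ 0) : v ⊗ₜ[ℂ] w ≠ 0 := by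
  obtain ⟨φ, hφ⟩ := Module.Projective.exists_dual_ne_zero ℂ hv
  obtain ⟨ψ, hψ⟩ := Module.Projective.exists_dual_ne_zero ℂ hw
  intro h
  have h' : TensorProduct.lift ((LinearMap.mul ℂ ℂ).compl₁₂ φ ψ) (v ⊗ₜ[ℂ] w) = φ v * ψ w := by
    rw [TensorProduct.lift.tmul]
    rfl
  rw [h, map_zero] at h'
  exact mul_ne_zero hφ hψ h'.symm

/-- The monomial with no Lefschetz operators is the cross product `p ⊠ q`. [folklore] -/
theorem mono_zero_zero {N : ℕ} (h : i₁ + 2 * 0 + (i₂ + 2 * 0) = N) (h' : i₁ + i₂ = N) :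
    cupProduct h (complexBetti.map (fst V W) (i₁ + 2 * 0) (lefschetzPowTo η₁ 0 i₁ (i₁ + 2 * 0) rfl p))
        (complexBetti.map (snd V W) (i₂ + 2 * 0) (lefschetzPowTo η₂ 0 i₂ (i₂ + 2 * 0) rfl q)) =
      cupProduct h' (complexBetti.map (fst V W) i₁ p) (complexBetti.map (snd V W) i₂ q) := by
  subst h'
  rfl

/-- **The monomials of a block are linearly independent** (Künneth, Kleiman's axiom (B), here a theorem of the
real carriers): for `η₁`, `η₂` with the hard Lefschetz property and `p`, `q` nonzero, the monomials
`L₁ˢ p ⊠ L₂ᵗ q`, `s ≤ m₁`, `t ≤ m₂` (`i₁ + m₁ = d₁`, `i₂ + m₂ = d₂`), of one total degree are linearly independent: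
they have pairwise distinct bidegrees, their Künneth components `L₁ˢ p ⊗ L₂ᵗ q` are nonzero (`Lˢ` is injective
below the top of a string) and the Künneth map is an isomorphism (`exists_kunnethEquiv`).
[cite: Kleiman1968AlgebraicCycles, §1.2 (B) and §1.4] [cite: HatcherAT2002, §3.2 Thm. 3.16] -/
theorem linearIndependent_mono (hV : IsSmoothProjective d₁ V) (hW : IsSmoothProjective d₂ W)
    (hη₁ : HasHardLefschetzProperty η₁ d₁) (hη₂ : HasHardLefschetzProperty η₂ d₂) {m₁ m₂ : ℕ}
    (hm₁ : i₁ + m₁ = d₁) (hm₂ : i₂ + m₂ = d₂) (hp0 : p ≠ 0) (hq0 : q ≠ 0) (N : ℕ) :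
    LinearIndependent ℂ (fun st : {st : Fin (m₁ + 1) × Fin (m₂ + 1) //
          i₁ + 2 * (st.1 : ℕ) + (i₂ + 2 * (st.2 : ℕ)) = N} ↦
        cupProduct st.2 (complexBetti.map (fst V W) (i₁ + 2 * (st.1.1 : ℕ))
            (lefschetzPowTo η₁ (st.1.1 : ℕ) i₁ (i₁ + 2 * (st.1.1 : ℕ)) rfl p))
          (complexBetti.map (snd V W) (i₂ + 2 * (st.1.2 : ℕ))
            (lefschetzPowTo η₂ (st.1.2 : ℕ) i₂ (i₂ + 2 * (st.1.2 : ℕ)) rfl q))) := by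
  classical
  obtain ⟨e, he⟩ := exists_kunnethEquiv hV hW N
  -- the Künneth preimages of the monomials: elementary tensors in distinct summands
  let idx : {st : Fin (m₁ + 1) × Fin (m₂ + 1) // i₁ + 2 * (st.1 : ℕ) + (i₂ + 2 * (st.2 : ℕ)) = N} →
      ↥(Finset.HasAntidiagonal.antidiagonal N) := fun st ↦
    ⟨(i₁ + 2 * (st.1.1 : ℕ), i₂ + 2 * (st.1.2 : ℕ)), Finset.HasAntidiagonal.mem_antidiagonal.mpr st.2⟩
  have hidx : Function.Injective idx := by
    intro x y hxy
    have h1 := congrArg (fun ij : ↥(Finset.HasAntidiagonal.antidiagonal N) ↦ ij.1.1) hxy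
    have h2 := congrArg (fun ij : ↥(Finset.HasAntidiagonal.antidiagonal N) ↦ ij.1.2) hxy
    simp only [idx] at h1 h2
    exact Subtype.ext (Prod.ext (Fin.ext (by omega)) (Fin.ext (by omega)))
  have hpre : ∀ st : {st : Fin (m₁ + 1) × Fin (m₂ + 1) // i₁ + 2 * (st.1 : ℕ) + (i₂ + 2 * (st.2 : ℕ)) = N},
      cupProduct st.2 (complexBetti.map (fst V W) (i₁ + 2 * (st.1.1 : ℕ))
            (lefschetzPowTo η₁ (st.1.1 : ℕ) i₁ (i₁ + 2 * (st.1.1 : ℕ)) rfl p))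
          (complexBetti.map (snd V W) (i₂ + 2 * (st.1.2 : ℕ))
            (lefschetzPowTo η₂ (st.1.2 : ℕ) i₂ (i₂ + 2 * (st.1.2 : ℕ)) rfl q)) =
        e (DirectSum.lof ℂ _ (fun ij : ↥(Finset.HasAntidiagonal.antidiagonal N) ↦
            complexBetti V ij.1.1 ⊗[ℂ] complexBetti W ij.1.2) (idx st)
          (lefschetzPowTo η₁ (st.1.1 : ℕ) i₁ (i₁ + 2 * (st.1.1 : ℕ)) rfl p ⊗ₜ
            lefschetzPowTo η₂ (st.1.2 : ℕ) i₂ (i₂ + 2 * (st.1.2 : ℕ)) rfl q)) := fun st ↦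
    (he _ _ st.2 _ _).symm
  rw [linearIndependent_iff']
  intro S g hg x₀ hx₀
  -- transport the relation through `e⁻¹` and take the component of index `idx x₀`
  have hg' : ∑ st ∈ S, g st • DirectSum.lof ℂ _ (fun ij : ↥(Finset.HasAntidiagonal.antidiagonal N) ↦
        complexBetti V ij.1.1 ⊗[ℂ] complexBetti W ij.1.2) (idx st)
      (lefschetzPowTo η₁ (st.1.1 : ℕ) i₁ (i₁ + 2 * (st.1.1 : ℕ)) rfl p ⊗ₜ
        lefschetzPowTo η₂ (st.1.2 : ℕ) i₂ (i₂ + 2 * (st.1.2 : ℕ)) rfl q) = 0 := by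
    apply e.injective
    rw [map_sum, map_zero]
    simpa only [map_smul, ← hpre] using hg
  have key := congrArg (DirectSum.component ℂ _ (fun ij : ↥(Finset.HasAntidiagonal.antidiagonal N) ↦
      complexBetti V ij.1.1 ⊗[ℂ] complexBetti W ij.1.2) (idx x₀)) hg'
  rw [map_sum, map_zero, Finset.sum_eq_single_of_mem x₀ hx₀] at key
  · rw [map_smul, DirectSum.component.lof_self] at key
    refine (smul_eq_zero.mp key).resolve_right (tmul_ne_zero' ?_ ?_)
    · have h1 := x₀.1.1.isLt
      intro h0
      exact hp0 (injective_lefschetzPowTo_of_le _ _ hη₁ (t := (x₀.1.1 : ℕ)) (by omega) rfl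
        (by rw [h0, map_zero]))
    · have h2 := x₀.1.2.isLt
      intro h0
      exact hq0 (injective_lefschetzPowTo_of_le _ _ hη₂ (t := (x₀.1.2 : ℕ)) (by omega) rfl
        (by rw [h0, map_zero]))
  · intro x _ hx
    rw [map_smul, DirectSum.component.of, dif_neg (fun h ↦ hx (hidx h)), smul_zero]

/-! ## §2 Hard Lefschetz inside a block -/

/-- **Hard Lefschetz inside a block**: for `p`, `q` primitive, `θ = fst^* η₁ + snd^* η₂` with the hard
Lefschetz property on the `(d₁ + d₂)`-fold `V ⊗ W`, and `i + r = d₁ + d₂`, every class of the block of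
`(p, q)` in degree `i + 2r` is `L_θʳ` of a class of the block in degree `i`: `L_θʳ` is injective on
`Hⁱ((V ⊗ W)(ℂ); ℂ)` and the two pieces of the block have the same dimension (`linearIndependent_mono` and the index bijection
`(s, t) ↦ (m₁ - s, m₂ - t)`, the tree's `Motives.WeilCohomology.card_blockIndex_eq`). [cite: Andre1996Motifs, §1.3 (pp. 12–13)] [cite: Kleiman1968AlgebraicCycles, Thm. 2.9] -/
theorem block_hardLefschetz (hV : IsSmoothProjective d₁ V) (hW : IsSmoothProjective d₂ W)
    (hη₁ : HasHardLefschetzProperty η₁ d₁) (hη₂ : HasHardLefschetzProperty η₂ d₂)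
    (hθ : HasHardLefschetzProperty (complexBetti.map (fst V W) 2 η₁ + complexBetti.map (snd V W) 2 η₂) (d₁ + d₂))
    (hp : p ∈ primitiveClasses η₁ d₁ i₁) (hq : q ∈ primitiveClasses η₂ d₂ i₂) {i r j : ℕ}
    (hr : i + r = d₁ + d₂) (h : i + 2 * r = j) {z : complexBetti (V ⊗ W) j}
    (hz : z ∈ Submodule.span ℂ {z : complexBetti (V ⊗ W) j | ∃ (s t : ℕ) (h : i₁ + 2 * s + (i₂ + 2 * t) = j),
        z = cupProduct h (complexBetti.map (fst V W) (i₁ + 2 * s) (lefschetzPowTo η₁ s i₁ (i₁ + 2 * s) rfl p))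
          (complexBetti.map (snd V W) (i₂ + 2 * t) (lefschetzPowTo η₂ t i₂ (i₂ + 2 * t) rfl q))}) :
    ∃ w ∈ Submodule.span ℂ {z : complexBetti (V ⊗ W) i | ∃ (s t : ℕ) (h : i₁ + 2 * s + (i₂ + 2 * t) = i),
        z = cupProduct h (complexBetti.map (fst V W) (i₁ + 2 * s) (lefschetzPowTo η₁ s i₁ (i₁ + 2 * s) rfl p))
          (complexBetti.map (snd V W) (i₂ + 2 * t) (lefschetzPowTo η₂ t i₂ (i₂ + 2 * t) rfl q))},
      lefschetzPowTo (complexBetti.map (fst V W) 2 η₁ + complexBetti.map (snd V W) 2 η₂) r i j h w = z := by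
  classical
  have hP : IsSmoothProjective (d₁ + d₂) (V ⊗ W) := IsSmoothProjective.tensor_holds hV hW
  -- degenerate blocks
  by_cases hp0 : p = 0
  · subst hp0
    have hz0 : z = 0 := by
      rw [← Submodule.mem_bot ℂ, ← (Submodule.span_eq_bot.2 _ : _ = ⊥)]
      · exact hz
      · rintro _ ⟨s, t, h', rfl⟩
        rw [map_zero, map_zero, LinearMap.map_zero₂]
    exact ⟨0, zero_mem _, by rw [hz0, map_zero]⟩
  by_cases hq0 : q = 0
  · subst hq0
    have hz0 : z = 0 := by
      rw [← Submodule.mem_bot ℂ, ← (Submodule.span_eq_bot.2 _ : _ = ⊥)]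
      · exact hz
      · rintro _ ⟨s, t, h', rfl⟩
        rw [map_zero, map_zero, map_zero]
    exact ⟨0, zero_mem _, by rw [hz0, map_zero]⟩
  -- live blocks: dimension count
  have hi₁ : i₁ ≤ d₁ := not_lt.mp fun hlt ↦ hp0 (hp.1 hlt)
  have hi₂ : i₂ ≤ d₂ := not_lt.mp fun hlt ↦ hq0 (hq.1 hlt)
  obtain ⟨m₁, hm₁⟩ : ∃ m₁, i₁ + m₁ = d₁ := ⟨d₁ - i₁, by omega⟩
  obtain ⟨m₂, hm₂⟩ : ∃ m₂, i₂ + m₂ = d₂ := ⟨d₂ - i₂, by omega⟩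
  haveI := finite_complexBetti hP i
  haveI := finite_complexBetti hP j
  set Bi := Submodule.span ℂ {z : complexBetti (V ⊗ W) i | ∃ (s t : ℕ) (h : i₁ + 2 * s + (i₂ + 2 * t) = i),
        z = cupProduct h (complexBetti.map (fst V W) (i₁ + 2 * s) (lefschetzPowTo η₁ s i₁ (i₁ + 2 * s) rfl p))
          (complexBetti.map (snd V W) (i₂ + 2 * t) (lefschetzPowTo η₂ t i₂ (i₂ + 2 * t) rfl q))} with hBi
  set Bj := Submodule.span ℂ {z : complexBetti (V ⊗ W) j | ∃ (s t : ℕ) (h : i₁ + 2 * s + (i₂ + 2 * t) = j),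
        z = cupProduct h (complexBetti.map (fst V W) (i₁ + 2 * s) (lefschetzPowTo η₁ s i₁ (i₁ + 2 * s) rfl p))
          (complexBetti.map (snd V W) (i₂ + 2 * t) (lefschetzPowTo η₂ t i₂ (i₂ + 2 * t) rfl q))} with hBj
  have hmaps : ∀ x ∈ Bi,
      lefschetzPowTo (complexBetti.map (fst V W) 2 η₁ + complexBetti.map (snd V W) 2 η₂) r i j h x ∈ Bj :=
    fun x hx ↦ lefschetzPowTo_boxSum_mem_block r h hx
  let f := (lefschetzPowTo (complexBetti.map (fst V W) 2 η₁ + complexBetti.map (snd V W) 2 η₂) r i j h).restrict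
    hmaps
  have hinj : Function.Injective f := by
    intro x y hxy
    apply Subtype.ext
    apply (bijective_lefschetzPowTo_of_hasHardLefschetz _ hθ hr j h).1
    have := congrArg Subtype.val hxy
    simpa only [f, LinearMap.restrict_apply] using this
  have hfin : Module.finrank ℂ Bi = Module.finrank ℂ Bj := by
    refine le_antisymm (LinearMap.finrank_le_finrank_of_injective hinj) ?_
    calc Module.finrank ℂ Bj
        = Module.finrank ℂ (Submodule.span ℂ (Set.range fun st : {st : Fin (m₁ + 1) × Fin (m₂ + 1) //
              i₁ + 2 * (st.1 : ℕ) + (i₂ + 2 * (st.2 : ℕ)) = j} ↦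
            cupProduct st.2 (complexBetti.map (fst V W) (i₁ + 2 * (st.1.1 : ℕ))
                (lefschetzPowTo η₁ (st.1.1 : ℕ) i₁ (i₁ + 2 * (st.1.1 : ℕ)) rfl p))
              (complexBetti.map (snd V W) (i₂ + 2 * (st.1.2 : ℕ))
                (lefschetzPowTo η₂ (st.1.2 : ℕ) i₂ (i₂ + 2 * (st.1.2 : ℕ)) rfl q)))) := by
          rw [hBj, block_eq_span_range hp hq hm₁ hm₂ j]
      _ ≤ Fintype.card {st : Fin (m₁ + 1) × Fin (m₂ + 1) //
              i₁ + 2 * (st.1 : ℕ) + (i₂ + 2 * (st.2 : ℕ)) = j} := finrank_range_le_card _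
      _ = Fintype.card {st : Fin (m₁ + 1) × Fin (m₂ + 1) //
              i₁ + 2 * (st.1 : ℕ) + (i₂ + 2 * (st.2 : ℕ)) = i} :=
          WeilCohomology.card_blockIndex_eq (by omega)
      _ = Module.finrank ℂ (Submodule.span ℂ (Set.range fun st : {st : Fin (m₁ + 1) × Fin (m₂ + 1) //
              i₁ + 2 * (st.1 : ℕ) + (i₂ + 2 * (st.2 : ℕ)) = i} ↦
            cupProduct st.2 (complexBetti.map (fst V W) (i₁ + 2 * (st.1.1 : ℕ))
                (lefschetzPowTo η₁ (st.1.1 : ℕ) i₁ (i₁ + 2 * (st.1.1 : ℕ)) rfl p))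
              (complexBetti.map (snd V W) (i₂ + 2 * (st.1.2 : ℕ))
                (lefschetzPowTo η₂ (st.1.2 : ℕ) i₂ (i₂ + 2 * (st.1.2 : ℕ)) rfl q)))) :=
          (finrank_span_eq_card (linearIndependent_mono hV hW hη₁ hη₂ hm₁ hm₂ hp0 hq0 i)).symm
      _ = Module.finrank ℂ Bi := by
          rw [hBi, block_eq_span_range hp hq hm₁ hm₂ i]
  obtain ⟨⟨w, hw⟩, hfw⟩ :=
    (LinearMap.injective_iff_surjective_of_finrank_eq_finrank hfin).1 hinj ⟨z, hz⟩
  refine ⟨w, hw, ?_⟩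
  have := congrArg Subtype.val hfw
  simpa only [f, LinearMap.restrict_apply] using this

/-! ## §3 Blocks are stable under André's involution `*_θ` -/

/-- **Blocks are stable under `*_θ`** (André's Lefschetz involution of `θ = fst^* η₁ + snd^* η₂`,
`HodgeTheory.lefschetzInvolution`): below the middle degree `*_θ = L_θ^{D-a}` maps blocks to blocks; above it
`*_θ` is the inverse Lefschetz isomorphism, and the hard-Lefschetz isomorphisms restrict to blocks
(`block_hardLefschetz`). [cite: Andre1996Motifs, §1.1 (p. 10) and §1.3 (pp. 12–13)] -/
theorem lefschetzInvolution_boxSum_mem_block (hV : IsSmoothProjective d₁ V) (hW : IsSmoothProjective d₂ W)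
    (hη₁ : HasHardLefschetzProperty η₁ d₁) (hη₂ : HasHardLefschetzProperty η₂ d₂)
    (hθ : HasHardLefschetzProperty (complexBetti.map (fst V W) 2 η₁ + complexBetti.map (snd V W) 2 η₂) (d₁ + d₂))
    (hp : p ∈ primitiveClasses η₁ d₁ i₁) (hq : q ∈ primitiveClasses η₂ d₂ i₂) {a b : ℕ}
    (hab : a + b = 2 * (d₁ + d₂)) {y : complexBetti (V ⊗ W) a}
    (hy : y ∈ Submodule.span ℂ {z : complexBetti (V ⊗ W) a | ∃ (s t : ℕ) (h : i₁ + 2 * s + (i₂ + 2 * t) = a),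
        z = cupProduct h (complexBetti.map (fst V W) (i₁ + 2 * s) (lefschetzPowTo η₁ s i₁ (i₁ + 2 * s) rfl p))
          (complexBetti.map (snd V W) (i₂ + 2 * t) (lefschetzPowTo η₂ t i₂ (i₂ + 2 * t) rfl q))}) :
    lefschetzInvolution hθ hab y ∈
      Submodule.span ℂ {z : complexBetti (V ⊗ W) b | ∃ (s t : ℕ) (h : i₁ + 2 * s + (i₂ + 2 * t) = b),
        z = cupProduct h (complexBetti.map (fst V W) (i₁ + 2 * s) (lefschetzPowTo η₁ s i₁ (i₁ + 2 * s) rfl p))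
          (complexBetti.map (snd V W) (i₂ + 2 * t) (lefschetzPowTo η₂ t i₂ (i₂ + 2 * t) rfl q))} := by
  by_cases ha : a ≤ d₁ + d₂
  · obtain ⟨j, hj⟩ : ∃ j, a + j = d₁ + d₂ := ⟨d₁ + d₂ - a, by omega⟩
    obtain rfl : b = a + 2 * j := by omega
    rw [lefschetzInvolution_apply_of_le hθ hj hab y, ← lefschetzPowTo_eq_lefschetzPow]
    exact lefschetzPowTo_boxSum_mem_block j rfl hy
  · obtain ⟨j, hj⟩ : ∃ j, b + j = d₁ + d₂ := ⟨d₁ + d₂ - b, by omega⟩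
    obtain rfl : a = b + 2 * j := by omega
    obtain ⟨w, hw, rfl⟩ := block_hardLefschetz hV hW hη₁ hη₂ hθ hp hq hj rfl hy
    rw [lefschetzPowTo_eq_lefschetzPow, lefschetzInvolution_lefschetzPow hθ hj hab w]
    exact hw

/-! ## §4 Lemme 1.3.1: `*_θ` of the top monomial -/

/-- **Lemme 1.3.1 (top of a block).** For `p ∈ P^{i₁}(V)`, `q ∈ P^{i₂}(W)` primitive (`i₁ + m₁ = d₁`,
`i₂ + m₂ = d₂`) and `θ = fst^* η₁ + snd^* η₂`: `*_θ (L₁^{m₁} p ⊠ L₂^{m₂} q) = c • (p ⊠ q)` with `c ≠ 0`. Indeed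
`L_θ^{m₁+m₂} (p ⊠ q)` is a combination of the monomials with `s + t = m₁ + m₂`, all of which vanish except the
top one, so `L_θ^{m₁+m₂} (p ⊠ q) = c' • (L₁^{m₁} p ⊠ L₂^{m₂} q)` with `c' ≠ 0` unless `p ⊠ q = 0` (hard Lefschetz
for `θ`: `i₁ + i₂ + (m₁ + m₂) = d₁ + d₂`), and `*_θ (L_θ^{m₁+m₂} (p ⊠ q)) = p ⊠ q` (above the middle degree `*_θ`
inverts the Lefschetz isomorphism). André: «les isomorphismes `L^{d-i}Pⁱ(X) ⊗ L^{d'-j}Pʲ(Y) → Pⁱ(X) ⊗ Pʲ(Y)`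
induits par l'involution de Lefschetz relative à `X × Y` d'une part, et par `*_L ⊗ *_L` d'autre part,
coïncident [à un facteur près]». [cite: Andre1996Motifs, §1.3 Lemme 1.3.1 (p. 13)] -/
theorem lefschetzInvolution_boxSum_topMono (hV : IsSmoothProjective d₁ V) (hW : IsSmoothProjective d₂ W)
    (hθ : HasHardLefschetzProperty (complexBetti.map (fst V W) 2 η₁ + complexBetti.map (snd V W) 2 η₂) (d₁ + d₂))
    (hp : p ∈ primitiveClasses η₁ d₁ i₁) (hq : q ∈ primitiveClasses η₂ d₂ i₂) {m₁ m₂ : ℕ}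
    (hm₁ : i₁ + m₁ = d₁) (hm₂ : i₂ + m₂ = d₂) {N : ℕ} (hN : i₁ + 2 * m₁ + (i₂ + 2 * m₂) = N)
    (hNN : N + (i₁ + i₂) = 2 * (d₁ + d₂)) :
    ∃ c : ℂ, c ≠ 0 ∧
      lefschetzInvolution hθ hNN
          (cupProduct hN (complexBetti.map (fst V W) (i₁ + 2 * m₁) (lefschetzPowTo η₁ m₁ i₁ (i₁ + 2 * m₁) rfl p))
            (complexBetti.map (snd V W) (i₂ + 2 * m₂) (lefschetzPowTo η₂ m₂ i₂ (i₂ + 2 * m₂) rfl q))) =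
        c • cupProduct rfl (complexBetti.map (fst V W) i₁ p) (complexBetti.map (snd V W) i₂ q) := by
  have hP : IsSmoothProjective (d₁ + d₂) (V ⊗ W) := IsSmoothProjective.tensor_holds hV hW
  -- `L_θ^{m₁+m₂} (p ⊠ q)` is a multiple of the top monomial
  have hmem := lefschetzPowTo_boxSum_cross_mem_monoSpan (η₁ := η₁) (η₂ := η₂) (p := p) (q := q) (m₁ + m₂)
    (M := N) (by omega)
  have hle : Submodule.span ℂ {z : complexBetti (V ⊗ W) N | ∃ (s t : ℕ) (_ : s + t = m₁ + m₂)
      (h : i₁ + 2 * s + (i₂ + 2 * t) = N),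
      z = cupProduct h (complexBetti.map (fst V W) (i₁ + 2 * s) (lefschetzPowTo η₁ s i₁ (i₁ + 2 * s) rfl p))
        (complexBetti.map (snd V W) (i₂ + 2 * t) (lefschetzPowTo η₂ t i₂ (i₂ + 2 * t) rfl q))} ≤
      ℂ ∙ cupProduct hN (complexBetti.map (fst V W) (i₁ + 2 * m₁) (lefschetzPowTo η₁ m₁ i₁ (i₁ + 2 * m₁) rfl p))
        (complexBetti.map (snd V W) (i₂ + 2 * m₂) (lefschetzPowTo η₂ m₂ i₂ (i₂ + 2 * m₂) rfl q)) := by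
    refine Submodule.span_le.2 ?_
    rintro _ ⟨s, t, hst, h', rfl⟩
    by_cases hs : s = m₁
    · obtain rfl := hs
      obtain rfl : t = m₂ := by omega
      exact Submodule.mem_span_singleton_self _
    by_cases hs' : d₁ + 1 ≤ i₁ + s
    · rw [mono_eq_zero_left hp h' hs']
      exact zero_mem _
    · rw [mono_eq_zero_right hq h' (by omega)]
      exact zero_mem _
  obtain ⟨c', hc'⟩ := Submodule.mem_span_singleton.1 (hle hmem)
  -- `*_θ (L_θ^{m₁+m₂} (p ⊠ q)) = p ⊠ q`
  have hstar : lefschetzInvolution hθ hNN (lefschetzPowTo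
      (complexBetti.map (fst V W) 2 η₁ + complexBetti.map (snd V W) 2 η₂) (m₁ + m₂) (i₁ + i₂) N (by omega)
      (cupProduct rfl (complexBetti.map (fst V W) i₁ p) (complexBetti.map (snd V W) i₂ q))) =
      cupProduct rfl (complexBetti.map (fst V W) i₁ p) (complexBetti.map (snd V W) i₂ q) :=
    lefschetzInvolution_lefschetzPowTo hθ (show i₁ + i₂ + (m₁ + m₂) = d₁ + d₂ by omega) N _ hNN _
  by_cases hc0 : c' = 0
  · -- then `L_θ^{m₁+m₂} (p ⊠ q) = 0`, so `p ⊠ q = 0`, and the top monomial `𝓛₁^{m₁} 𝓛₂^{m₂} (p ⊠ q)` vanishes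
    rw [hc0, zero_smul] at hc'
    have hpq : cupProduct rfl (complexBetti.map (fst V W) i₁ p) (complexBetti.map (snd V W) i₂ q) = 0 :=
      (bijective_lefschetzPowTo_of_hasHardLefschetz _ hθ (show i₁ + i₂ + (m₁ + m₂) = d₁ + d₂ by omega) N
        (by omega)).1 (by rw [← hc', map_zero])
    refine ⟨1, one_ne_zero, ?_⟩
    have htop : cupProduct hN (complexBetti.map (fst V W) (i₁ + 2 * m₁) (lefschetzPowTo η₁ m₁ i₁ (i₁ + 2 * m₁) rfl p))
        (complexBetti.map (snd V W) (i₂ + 2 * m₂) (lefschetzPowTo η₂ m₂ i₂ (i₂ + 2 * m₂) rfl q)) = 0 := by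
      rw [← lefschetzPowTo_fst_pow_mono m₁ 0 m₂ (by omega : 0 + m₁ = m₁) (i₁ + 2 * 0 + (i₂ + 2 * m₂)) N
          (by omega) (by omega) hN,
        ← lefschetzPowTo_snd_pow_mono m₂ 0 0 (by omega : 0 + m₂ = m₂) (i₁ + i₂) (i₁ + 2 * 0 + (i₂ + 2 * m₂))
          (by omega) (by omega), mono_zero_zero _ rfl, hpq, map_zero, map_zero]
    rw [htop, map_zero, hpq, smul_zero]
  · refine ⟨c'⁻¹, inv_ne_zero hc0, ?_⟩
    have htop : cupProduct hN (complexBetti.map (fst V W) (i₁ + 2 * m₁) (lefschetzPowTo η₁ m₁ i₁ (i₁ + 2 * m₁) rfl p))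
        (complexBetti.map (snd V W) (i₂ + 2 * m₂) (lefschetzPowTo η₂ m₂ i₂ (i₂ + 2 * m₂) rfl q)) =
        c'⁻¹ • lefschetzPowTo (complexBetti.map (fst V W) 2 η₁ + complexBetti.map (snd V W) 2 η₂) (m₁ + m₂)
          (i₁ + i₂) N (by omega)
          (cupProduct rfl (complexBetti.map (fst V W) i₁ p) (complexBetti.map (snd V W) i₂ q)) := by
      rw [← hc', smul_smul, inv_mul_cancel₀ hc0, one_smul]
    rw [htop, map_smul, hstar]

end Summit.HodgeConjecture.HodgeConjecture.Theorems

end
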